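import Mathlib
import Summits.CriticalPhenomena.PercolationContinuityZ3.Theses.PercBudgetLadder
import Summits.CriticalPhenomena.PercolationContinuityZ3.Theorems.PinholeClosing.Negative.PinholeClosingResistance
import Summits.CriticalPhenomena.PercolationContinuityZ3.Theorems.PercBudgetLadderSufficesTarget
import Summits.CriticalPhenomena.PercolationContinuityZ3.Theorems.PercBudgetLadderBlockingVanishesOfTheta
import Summits.CriticalPhenomena.PercolationContinuityZ3.Theorems.PercBudgetLadderPinholeClosingShellExclusion
import Summits.CriticalPhenomena.PercolationContinuityZ3.Theorems.PercBudgetLadderPinholeClosingShellMerge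
import Summits.CriticalPhenomena.PercolationContinuityZ3.Theorems.PercBudgetLadderPinholeClosingShellSqueeze
import Literature.Probability.Percolation.MinOpenCut
import Literature.Probability.Percolation.SiteConnectionTools
import HarnessLib

/-!
# Crux `PercBudgetLadder.PinholeClosing` (stmt-CriticalPhenomena-5249) — the RESTATED crux proved; `BudgetTightness ⇒ θ(p_c) = 0`

Lead `prover-line-stmt-CriticalPhenomena-5249-c3-0`, line `budget-halving` in SHELL form (skeleton
`Cruxes/PinholeClosing/Lines/budget_halving.lean`; landed stubs `stub_blockedOfShell` + deterministic core
(`…ShellExclusion.lean`), `stub_chartMerge` (`…ShellChart.lean`), `stub_shellMerge` (`…ShellMerge.lean`),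
`stub_shellSqueeze` (`…ShellSqueeze.lean`)).  This file is the composition:

* `ShellHalving.exclusion` (deterministic, lattice configurations): if every SURFACE grid translate `u • z`
  (`‖z‖∞ = 4l`) of the window `box n → ∂ⁱⁿ box (3lu)` is blocked after closing `≤ j` edges (`j ≥ 1`,
  `2u ≤ n ≤ 3u`, `l ≥ 2`), then at some grid translate `u • z`, `‖z‖∞ ≤ 4l` (in fact at the centre) the window
  `box u → ∂ⁱⁿ box (12lu)` is blocked after closing `≤ j - 1` edges.  Mechanism: otherwise floors hold at every
  surface translate, `stub_shellMerge` merges the window pockets over the cube surface into ONE finite `V` with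
  `≤ j` open boundary edges containing the sphere `‖x‖∞ = 4lu`, and the two-sided cut `stub_blockedOfShell`
  (inner-side doors and outer-side doors of `V` are each a cutset; one class has `≤ ⌊j/2⌋ ≤ j - 1` edges) blocks the
  centred window — contradicting the centre floor.  No door calculus, no isoperimetry, every budget level.
* `pinholeClosingRestated_proof`: **the restated crux** — for all `k, l ≥ 2, c > 0` there are `j (= 2)`,
  `l' (= 12 l)`, `c' > 0` such that for every `n ≥ 1`, if the annulus `box n → ∂ⁱⁿ box (ln)` is budget-`(k+1)`
  blocked with probability `≥ c`, then for some `m` with `n ≤ 2^j m` (namely `m = ⌊n/2⌋`, or `m = 1` for `n = 1`)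
  the annulus `box m → ∂ⁱⁿ box (l' m)` is budget-`k` blocked with probability `≥ c'`
  (`c' = min (c^N / N) (P(budget k at (1, 12l)))`, `N = (8l+1)³`: Harris over the caps, union bound over the grid,
  shift invariance — `stub_shellSqueeze`; finite energy for `n = 1`).  The body is VERBATIM
  `PercBudgetLadder.PinholeClosingRestated` of `Cruxes/PinholeClosing/RestatedGlue_cruxplan_budget_halving.lean`, whose
  deciding theorem `closes_restated : BudgetTightness → PinholeClosingRestated → BlockingVanishesOfTheta →
  PercolationContinuityZ3` the crux-plan seat certified.
* `critAnnulusBlockedIO_of_budgetTightness : BudgetTightness → CritAnnulusBlockedIO` and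
  `percolationContinuityZ3_of_budgetTightness : BudgetTightness → PercolationContinuityZ3` — UNCONDITIONAL in
  everything but `BudgetTightness` (r2): through this line the crux `PinholeClosing` (r3) is no longer load-bearing
  for the route.

NOT claimed: the decl `PinholeClosing` AS TYPED (conclusion at the SAME inner radius `n` and outer radius `2ln`).
At equal inner radii no deterministic exclusion exists (line worlds `CorridorWorlds-ideator2.md`; finite
certificates `TilingNoGoK1-cert.md`), and the typed decl is strictly stronger than what `closes` consumes; the lead's
verdict is `misstated` with the restated body above.  No definitions in this file.
-/

noncomputable section

namespace Summit.CriticalPhenomena.PercolationContinuityZ3.Theorems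

open MeasureTheory
open scoped Classical
open Literature.Probability.Percolation Literature.Probability.LatticeModels
open Summit.CriticalPhenomena.PercolationContinuityZ3.Theses
open Summit.CriticalPhenomena.PercolationContinuityZ3.Theorems.PinholeClosing

namespace ShellHalving

/-- Translating by `0` does nothing. -/
theorem image_add_zero (s : Finset (Site 3)) : s.image (· + (0 : Site 3)) = s := by
  simp

/-- `0 ∈ box 3 R`. -/
theorem zero_mem_box (R : ℕ) : (0 : Site 3) ∈ box 3 R := by
  rw [mem_box]
  intro i
  simp

/-- **Exclusion (deterministic).**  On a lattice configuration, caps at every surface translate force the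
conclusion window `box u → ∂ⁱⁿ box (12lu)` to be budget-`(j-1)` blocked at some grid translate `u • z`,
`‖z‖∞ ≤ 4l` (in fact at `z = 0`): otherwise the floors hold at every surface translate and at the centre,
`stub_shellMerge` produces the shell bag `V`, and `stub_blockedOfShell` blocks the centred window — contradicting
the centre floor. -/
theorem exclusion (j n l u : ℕ) (hj : 1 ≤ j) (hl : 2 ≤ l) (hu : 1 ≤ u) (h2u : 2 * u ≤ n) (h3u : n ≤ 3 * u)
    (ω : BondConfig (Site 3)) (hω : ω ⊆ (zdGraph 3).edgeSet)
    (hcaps : ∀ z ∈ box 3 (4 * l), z ∉ box 3 (4 * l - 1) →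
      ∃ S : Finset (Sym2 (Site 3)), S.card ≤ j ∧ ¬ ∃ x ∈ (box 3 n).image (· + (u : ℤ) • z),
        ∃ y ∈ (innerBoundary (zdGraph 3) (box 3 (3 * l * u))).image (· + (u : ℤ) • z),
          (ω \ (↑S : Set (Sym2 (Site 3)))) ∈
            openConnIn (↑((box 3 (3 * l * u)).image (· + (u : ℤ) • z)) : Set (Site 3)) x y) :
    ∃ z ∈ box 3 (4 * l), ∃ S : Finset (Sym2 (Site 3)), S.card ≤ j - 1 ∧
      ¬ ∃ x ∈ (box 3 u).image (· + (u : ℤ) • z),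
        ∃ y ∈ (innerBoundary (zdGraph 3) (box 3 (12 * l * u))).image (· + (u : ℤ) • z),
          (ω \ (↑S : Set (Sym2 (Site 3)))) ∈
            openConnIn (↑((box 3 (12 * l * u)).image (· + (u : ℤ) • z)) : Set (Site 3)) x y := by
  by_contra hne
  push Not at hne
  obtain ⟨V, hV, hVu, hVM, hcov⟩ := stub_shellMerge j n l u ω hω hj hl hu h2u h3u hcaps
    (fun z hz _ => by rintro ⟨S, hS, hb⟩; exact hb (hne z hz S hS))
  have hlu : 1 ≤ l * u := Nat.mul_le_mul (by omega : 1 ≤ l) hu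
  have h8 : 8 * u ≤ 4 * l * u := Nat.mul_le_mul_right u (by omega)
  have hR : u + 1 ≤ 4 * l * u := by omega
  have hRM : 4 * l * u + 1 ≤ 12 * l * u := by
    rw [Nat.mul_assoc, Nat.mul_assoc]
    omega
  obtain ⟨S, hS, hb⟩ := stub_blockedOfShell j u (4 * l * u) (12 * l * u) ω V hω hj hR hRM hV hVu hVM hcov
  have h0 := hne 0 (zero_mem_box _) S hS
  rw [smul_zero, image_add_zero, image_add_zero, image_add_zero] at h0
  exact hb h0

end ShellHalving

open ShellHalving

/-- **The restated crux `PinholeClosingRestated`, PROVED** (`j = 2`, `l' = 12 l`,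
`c' = min (c^N / N) (P(budget k at (1, 12 l)))`, `N = (8l+1)³`).  For `n ≥ 2`: `u = ⌊n/2⌋`, the premise at aspect
`l` gives the centred cap at outer radius `3lu ≥ ln` (`blockProb_mono_aspect`), `stub_shellSqueeze` + `exclusion`
give the conclusion at `(u, 12lu)` with probability `≥ c^N / N`, and `n ≤ 4u`; for `n = 1` finite energy. -/
theorem pinholeClosingRestated_proof :
    ∀ (k l : ℕ) (c : ℝ), 2 ≤ l → 0 < c → ∃ (j l' : ℕ) (c' : ℝ), 2 ≤ l' ∧ 0 < c' ∧ ∀ n : ℕ, 1 ≤ n → c ≤ (Literature.Probability.Percolation.bondPercolation (Literature.Probability.LatticeModels.zdGraph 3) (Literature.Probability.Percolation.criticalProbI 3)).real {ω | ∃ S : Finset (Sym2 (Literature.Probability.LatticeModels.Site 3)), S.card ≤ k + 1 ∧ ¬ ∃ x ∈ Literature.Probability.LatticeModels.box 3 n, ∃ y ∈ Literature.Probability.LatticeModels.innerBoundary (Literature.Probability.LatticeModels.zdGraph 3) (Literature.Probability.LatticeModels.box 3 (l * n)), (ω \ ↑S) ∈ Literature.Probability.Percolation.openConnIn ↑(Literature.Probability.LatticeModels.box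 3 (l * n)) x y} → ∃ m : ℕ, n ≤ 2 ^ j * m ∧ c' ≤ (Literature.Probability.Percolation.bondPercolation (Literature.Probability.LatticeModels.zdGraph 3) (Literature.Probability.Percolation.criticalProbI 3)).real {ω | ∃ S : Finset (Sym2 (Literature.Probability.LatticeModels.Site 3)), S.card ≤ k ∧ ¬ ∃ x ∈ Literature.Probability.LatticeModels.box 3 m, ∃ y ∈ Literature.Probability.LatticeModels.innerBoundary (Literature.Probability.LatticeModels.zdGraph 3) (Literature.Probability.LatticeModels.box 3 (l' * m)), (ω \ ↑S) ∈ Literature.Probability.Percolation.openConnIn ↑(Literature.Probability.LatticeModels.box 3 (l' * m)) x y} := by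
  intro k l c hl hc
  have hNpos : (0 : ℝ) < (((8 * l + 1) ^ 3 : ℕ) : ℝ) := by positivity
  have h12 : 1 < 12 * l * 1 := by omega
  have hc₀ := Negative.blockProb_pos (k := k) h12
  refine ⟨2, 12 * l, min (c ^ ((8 * l + 1) ^ 3) / (((8 * l + 1) ^ 3 : ℕ) : ℝ))
      ((bondPercolation (zdGraph 3) (criticalProbI 3)).real
        {ω : BondConfig (Site 3) | ∃ S : Finset (Sym2 (Site 3)), S.card ≤ k ∧ ¬ ∃ x ∈ box 3 (1),
          ∃ y ∈ innerBoundary (zdGraph 3) (box 3 (12 * l * 1)),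
            (ω \ (↑S : Set (Sym2 (Site 3)))) ∈ openConnIn (↑(box 3 (12 * l * 1)) : Set (Site 3)) x y}),
    by omega, lt_min (div_pos (pow_pos hc _) hNpos) hc₀, ?_⟩
  intro n hn hprem
  rcases Nat.lt_or_ge n 2 with hn2 | hn2
  · -- n = 1: finite energy at m = 1
    obtain rfl : n = 1 := by omega
    exact ⟨1, by norm_num, min_le_right _ _⟩
  · -- n ≥ 2: u = ⌊n/2⌋, caps at aspect 3lu, squeeze + exclusion, n ≤ 4u
    set u : ℕ := n / 2 with hu_def
    have hu : 1 ≤ u := by omega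
    have h2u : 2 * u ≤ n := by omega
    have h3u : n ≤ 3 * u := by omega
    have h4u : n ≤ 2 ^ 2 * u := by
      have : 2 ^ 2 * u = 4 * u := by norm_num
      omega
    have hln : n ≤ l * n := Nat.le_mul_of_pos_left n (by omega)
    have hl3 : l * n ≤ 3 * l * u :=
      calc l * n ≤ l * (3 * u) := Nat.mul_le_mul_left l h3u
        _ = 3 * l * u := by ring
    have hcap := hprem.trans (Negative.blockProb_mono_aspect (k := k + 1) hln hl3)
    have hsq := stub_shellSqueeze (k + 1) n l u c hc.le hcap (fun ω hω hcaps =>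
      exclusion (k + 1) n l u (by omega) hl hu h2u h3u ω hω hcaps)
    simp only [Nat.add_sub_cancel] at hsq
    refine ⟨u, h4u, (min_le_left _ _).trans ?_⟩
    rw [div_le_iff₀ hNpos]
    exact hsq.trans_eq (mul_comm _ _)

/-- **Registered form** (`stub_pinholeClosingRestated` on stmt-CriticalPhenomena-5249): the restated crux, by
`pinholeClosingRestated_proof`. -/
theorem stub_pinholeClosingRestated :
    ∀ (k l : ℕ) (c : ℝ), 2 ≤ l → 0 < c → ∃ (j l' : ℕ) (c' : ℝ), 2 ≤ l' ∧ 0 < c' ∧ ∀ n : ℕ, 1 ≤ n → c ≤ (Literature.Probability.Percolation.bondPercolation (Literature.Probability.LatticeModels.zdGraph 3) (Literature.Probability.Percolation.criticalProbI 3)).real {ω | ∃ S : Finset (Sym2 (Literature.Probability.LatticeModels.Site 3)), S.card ≤ k + 1 ∧ ¬ ∃ x ∈ Literature.Probability.LatticeModels.box 3 n, ∃ y ∈ Literature.Probability.LatticeModels.innerBoundary (Literature.Probability.LatticeModels.zdGraph 3) (Literature.Probability.LatticeModels.box 3 (l * n)), (ω \ ↑S) ∈ Literature.Probability.Percolation.openConnIn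 ↑(Literature.Probability.LatticeModels.box 3 (l * n)) x y} → ∃ m : ℕ, n ≤ 2 ^ j * m ∧ c' ≤ (Literature.Probability.Percolation.bondPercolation (Literature.Probability.LatticeModels.zdGraph 3) (Literature.Probability.Percolation.criticalProbI 3)).real {ω | ∃ S : Finset (Sym2 (Literature.Probability.LatticeModels.Site 3)), S.card ≤ k ∧ ¬ ∃ x ∈ Literature.Probability.LatticeModels.box 3 m, ∃ y ∈ Literature.Probability.LatticeModels.innerBoundary (Literature.Probability.LatticeModels.zdGraph 3) (Literature.Probability.LatticeModels.box 3 (l' * m)), (ω \ ↑S) ∈ Literature.Probability.Percolation.openConnIn ↑(Literature.Probability.LatticeModels.box 3 (l' * m)) x y} :=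
  pinholeClosingRestated_proof

/-- **The ladder reaches the target under the restatement**: `BudgetTightness → CritAnnulusBlockedIO`
(pure logic on top of `pinholeClosingRestated_proof`, the `descent` of `closes_restated`: a `K`-step descent in
which the inner radius of the i.o. subsequence shrinks by `2^j` per step, hence still tends to infinity). -/
theorem critAnnulusBlockedIO_of_budgetTightness (hBT : PercBudgetLadder.BudgetTightness) :
    PercBudgetLadder.CritAnnulusBlockedIO := by
  have hPC := pinholeClosingRestated_proof
  -- dictionary, local to the proof
  let P : ℕ → ℕ → ℕ → ℝ := fun k n m =>
    (bondPercolation (zdGraph 3) (criticalProbI 3)).real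
      {ω | ∃ S : Finset (Sym2 (Site 3)), S.card ≤ k ∧ ¬ ∃ x ∈ box 3 n,
        ∃ y ∈ innerBoundary (zdGraph 3) (box 3 m), (ω \ ↑S) ∈ openConnIn ↑(box 3 m) x y}
  have descent : ∀ K : ℕ, ∀ (l : ℕ) (c : ℝ), 2 ≤ l → 0 < c →
      (∀ N : ℕ, ∃ n : ℕ, N ≤ n ∧ c ≤ P K n (l * n)) →
      ∃ (l' : ℕ) (c' : ℝ), 2 ≤ l' ∧ 0 < c' ∧ ∀ N : ℕ, ∃ n : ℕ, N ≤ n ∧ c' ≤ P 0 n (l' * n) := by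
    intro K
    induction K with
    | zero => exact fun l c hl hc h => ⟨l, c, hl, hc, h⟩
    | succ K ih =>
      intro l c hl hc h
      obtain ⟨j, l', c', hl', hc', hstep⟩ := hPC K l c hl hc
      refine ih l' c' hl' hc' fun N => ?_
      obtain ⟨n, hn, hb⟩ := h (2 ^ j * N + 1)
      obtain ⟨m, hm, hbm⟩ := hstep n (by omega) hb
      refine ⟨m, ?_, hbm⟩
      have h3 : 2 ^ j * N ≤ 2 ^ j * m := (Nat.le_of_succ_le hn).trans hm
      exact Nat.le_of_mul_le_mul_left h3 (Nat.two_pow_pos j)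
  obtain ⟨K, l, c, hl, hc, hio⟩ := hBT
  obtain ⟨l', c', hl', hc', hio'⟩ := descent K l c hl hc hio
  refine ⟨l', c', hl', hc', fun N => ?_⟩
  obtain ⟨n, hn, hbound⟩ := hio' N
  refine ⟨n, hn, ?_⟩
  have hset :
      {ω : Set (Sym2 (Site 3)) | ∃ S : Finset (Sym2 (Site 3)), S.card ≤ 0 ∧ ¬ ∃ x ∈ box 3 n,
          ∃ y ∈ innerBoundary (zdGraph 3) (box 3 (l' * n)), (ω \ ↑S) ∈ openConnIn ↑(box 3 (l' * n)) x y} =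
      {ω | ¬ ∃ x ∈ box 3 n, ∃ y ∈ innerBoundary (zdGraph 3) (box 3 (l' * n)),
          ω ∈ openConnIn ↑(box 3 (l' * n)) x y} := by
    ext ω
    constructor
    · rintro ⟨S, hS, hnot⟩
      have hS0 : S = ∅ := Finset.card_eq_zero.mp (Nat.le_zero.mp hS)
      subst hS0
      simpa using hnot
    · intro hnot
      exact ⟨∅, by simp, by simpa using hnot⟩
  have hb' : c' ≤ P 0 n (l' * n) := hbound
  simp only [P] at hb'
  rw [hset] at hb'
  exact hb'

/-- **`θ(p_c) = 0` on `ℤ³` from bounded-budget tightness ALONE**: `BudgetTightness → PercolationContinuityZ3`,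
by `critAnnulusBlockedIO_of_budgetTightness` and the route's proved `SufficesTarget` + `BlockingVanishesOfTheta`.
Through this line the crux `PinholeClosing` (r3) stops being load-bearing: the single open input of the
ladder is `BudgetTightness` (r2). -/
theorem percolationContinuityZ3_of_budgetTightness (hBT : PercBudgetLadder.BudgetTightness) :
    _root_.PercolationContinuityZ3 :=
  sufficesTarget_proof (critAnnulusBlockedIO_of_budgetTightness hBT) BlockingVanishesOfTheta_proof

end Summit.CriticalPhenomena.PercolationContinuityZ3.Theorems

end
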